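import Literature.NumberTheory.EllipticCurves.Kato2004.IwasawaH1ReductionKernel
import Literature.NumberTheory.EllipticCurves.Kato2004.IwasawaH1ReductionPk
import HarnessLib

/-!
# Kato 2004 (Astérisque 295) §13.8 at level `p^k`: the kernel of the reduction
# `red_{p^k} : H¹(U, T_pW) → H¹(U, W[p^k])` is `p^k · H¹(U, T_pW)` — every elliptic `W/ℚ`, every prime
# `p`, every subgroup `U ≤ Γ_ℚ`, every `k`

Topic `NumberTheory/EllipticCurves`, sub-directory `Kato2004` (namespace = path).  THEOREMS ONLY (no
definition, no named fact, no `sorry`).  The level-`p` case is the tree's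
`Kato2004.exists_smul_eq_of_reduceH1_eq_zero` / `reduceH1_eq_zero_iff` (file `IwasawaH1ReductionKernel`,
cell `bsd-potss`); this file is its verbatim generalisation to the reductions `reduceH1Pk W p k U`
(`IwasawaH1ReductionPk`, `[φ] ↦ [φ mod p^k]`) — the exactness of
`H¹(U, T_pW) →(p^k •) H¹(U, T_pW) → H¹(U, W[p^k])` at the middle term, on continuous cochains:
write `x = [φ]` with `red_{p^k}[φ] = 0`, i.e. `φ(g) mod p^k = g v − v` for some `v ∈ W[p^k]`; lift
`v = m mod p^k` with `m ∈ T_pW` (`T_pW → W[p^k]` is onto, tree theorem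
`WeierstrassCurve.proj_surjective_of_isAlgClosed_holds`); then `c'(g) := φ(g) − (g m − m)` has
`c'(g) mod p^k = 0`, so `c'(g) = p^k • d(g)` with `d(g)_n = c'(g)_{n+k}` — `d` is continuous and a crossed
homomorphism because `p^k •` of its defect vanishes and `T_pW` has no `p`-torsion — and
`[φ] = [c'] = p^k • [d]`.  Used by the INPUTS desk's road for the compact-versus-discrete Selmer rank
dictionary (stub `stub_rankIntegralH1LeSelmerCorankAtDoor` of crux stmt-BirchSwinnertonDyer-23752): the
kernel of «reduce modulo `p^k` and map to `Sel_{p^∞}[p^k]`» on `H¹(ℤ[1/p], T_pW)` is `p^k`-divisible in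
`H¹(Γ_ℚ, T_pW)`.

References: K. Kato, Astérisque 295 (2004), §13.8 (pp. 228–229: "`𝐇¹(T)/p → 𝐇¹(T/p)` is injective")
and §8.2 (p. 181: `H^q(R, T) = lim← H^q(R, T/p^n)`) [Kato2004Asterisque]; J.-P. Serre, *Abelian ℓ-adic
representations* (1968), I.1.1 (`T_ℓ`) [Serre1968].
-/

noncomputable section

open scoped NumberField
open Field CategoryTheory
open Literature.NumberTheory.GaloisRepresentations
open Literature.NumberTheory.EllipticCurves Literature.NumberTheory.EllipticCurves.Kato2004
open Literature.NumberTheory.EllipticCurves.Kato2004.EulerSystemValues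
open WeierstrassCurve (geomPoints geomTorsion)

universe u

/-! ## §1 `T_p A`: no `p^k`-torsion -/

namespace Literature.NumberTheory.EllipticCurves.TateModule

variable {A : Type u} [AddCommGroup A] {p : ℕ}

/-- **`T_p A` has no `p^k`-torsion**: `p^k • a = p^k • b → a = b` (iterate `eq_of_prime_nsmul_eq`).
[cite: Serre1968, Ch. I §1.1] -/
theorem eq_of_prime_pow_nsmul_eq (k : ℕ) {a b : TateModule A p} (h : p ^ k • a = p ^ k • b) : a = b := by
  induction k with
  | zero => simpa using h
  | succ k ih =>
    apply ih
    apply eq_of_prime_nsmul_eq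
    rw [smul_smul, smul_smul, ← pow_succ', h]

end Literature.NumberTheory.EllipticCurves.TateModule

/-! ## §2 The kernel of `red_{p^k} : H¹(U, T_pW) → H¹(U, W[p^k])` is `p^k · H¹(U, T_pW)` -/

namespace Literature.NumberTheory.EllipticCurves.Kato2004

variable (W : WeierstrassCurve ℚ) [W.IsElliptic] (p : ℕ) [Fact p.Prime]
  [ContinuousSMul ℤ_[p] (W.tateModule p)]

/-- **Kato §13.8 at level `p^k`: `ker red_{p^k} ⊆ p^k · H¹`.**  For every subgroup `U ≤ Γ_ℚ`, every `k`
and every `x ∈ H¹(U, T_pW)` whose reduction `red_{p^k} x ∈ H¹(U, W[p^k])` (`reduceH1Pk W p k U`) vanishes,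
`x = p^k • z` for some `z ∈ H¹(U, T_pW)` — exactness of `H¹(U, T_pW) →(p^k) H¹(U, T_pW) → H¹(U, W[p^k])`,
proved on continuous cochains exactly as the tree's level-`p` case `exists_smul_eq_of_reduceH1_eq_zero`
(module docstring). [cite: Kato2004Asterisque, §13.8 (pp. 228–229) and §8.2 (p. 181)] -/
theorem exists_pow_smul_eq_of_reduceH1Pk_eq_zero (k : ℕ) (U : Subgroup (absoluteGaloisGroup ℚ))
    (x : H1 (tateRep W p) U) (hx : reduceH1Pk W p k U x = 0) :
    ∃ z : H1 (tateRep W p) U, ((p : ℤ_[p]) ^ k) • z = x := by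
  obtain ⟨φ, rfl⟩ := oneCocycleClass_surjective _ x
  rw [reduceH1Pk_oneCocycleClass, oneCocycleClass_eq_zero_iff] at hx
  obtain ⟨v, hv⟩ := hx
  -- the action of `U` on `T_pW|_U` is the Galois action
  have hρ : ∀ (g : U) (a : W.tateModule p),
      (subgroupRep (tateRep W p).toTopRep U).ρ g a = (g : absoluteGaloisGroup ℚ) • a :=
    fun g a => rfl
  -- the values of `φ` reduce to the coboundary of `v`
  have hv' : ∀ g : U, TateModule.proj p k (φ.1 g) =
      (g : absoluteGaloisGroup ℚ) • (v : geomPoints W) - (v : geomPoints W) := fun g => by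
    have h := congrArg (fun P : geomTorsion W ((p : ℤ) ^ k) => (P : geomPoints W)) (hv g)
    simp only [AddSubgroupClass.coe_sub] at h
    exact h
  -- lift `v` to `m ∈ T_pW` (`T_pW → W[p^k]` is onto)
  have hvp : (v : geomPoints W) ∈ geomTorsion W (p ^ k : ℕ) := by rw [Nat.cast_pow]; exact v.2
  obtain ⟨m, hm⟩ := W.proj_surjective_of_isAlgClosed_holds p k hvp
  -- the corrected values `c' g = φ g − (g m − m)` reduce to `0` modulo `p^k`
  let c' : U → W.tateModule p := fun g =>
    φ.1 g - ((subgroupRep (tateRep W p).toTopRep U).ρ g m - m)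
  have hc'cont : Continuous c' :=
    φ.1.continuous.sub ((((tateRep W p).continuous_apply_left m).comp continuous_subtype_val).sub
      continuous_const)
  have hc'k : ∀ g, TateModule.proj p k (c' g) = 0 := fun g => by
    simp only [c', map_sub, hρ, TateModule.proj_smul_of_distribMulAction, hm, hv']
    abel
  have hc'mul : ∀ g h : U, c' (g * h) = c' g + (subgroupRep (tateRep W p).toTopRep U).ρ g (c' h) :=
    fun g h => by
    have hgh : (subgroupRep (tateRep W p).toTopRep U).ρ (g * h) m =
        (subgroupRep (tateRep W p).toTopRep U).ρ g ((subgroupRep (tateRep W p).toTopRep U).ρ h m) := by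
      rw [map_mul]; rfl
    simp only [c', φ.2 g h, hgh, map_sub]
    abel
  -- `d g := c' g / p^k`, coordinatewise `(d g)_n = (c' g)_{n+k}`
  let d₀ : U → W.tateModule p := fun g =>
    TateModule.mk (fun n => TateModule.proj p (n + k) (c' g))
      (fun n => by
        have h := TateModule.pow_smul_proj_add (c' g) k n
        rw [Nat.add_comm] at h
        rw [h, hc'k])
      (fun n => by
        have h := TateModule.smul_proj_succ (n + k) (c' g)
        rw [show n + 1 + k = n + k + 1 by omega]
        exact h)
  have hd₀ : ∀ g, p ^ k • d₀ g = c' g := fun g => by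
    refine TateModule.ext fun n => ?_
    rw [map_nsmul, TateModule.proj_mk, TateModule.pow_smul_proj_add]
  have hd₀cont : Continuous d₀ := by
    refine continuous_induced_rng.mpr (continuous_pi fun n => ?_)
    exact (TateModule.continuous_proj (n + k)).comp hc'cont
  -- `d` is a crossed homomorphism: `p^k •` of the defect vanishes and `T_pW` has no `p`-torsion
  have hdmul : ∀ g h : U, d₀ (g * h) = d₀ g + (subgroupRep (tateRep W p).toTopRep U).ρ g (d₀ h) :=
    fun g h => by
    refine TateModule.eq_of_prime_pow_nsmul_eq k ?_
    rw [hd₀, nsmul_add, hd₀, ← map_nsmul, hd₀, hc'mul]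
  let d : contOneCocycles (subgroupRep (tateRep W p).toTopRep U) := ⟨⟨d₀, hd₀cont⟩, hdmul⟩
  refine ⟨oneCocycleClass _ d, ?_⟩
  -- `[φ] = p^k • [d]`: `φ − p^k • d = ∂m`
  rw [← oneCocycleClass_smul, eq_comm, ← sub_eq_zero, ← oneCocycleClass_sub,
    oneCocycleClass_eq_zero_iff]
  refine ⟨m, fun g => ?_⟩
  rw [Submodule.coe_sub, ContinuousMap.sub_apply, Submodule.coe_smul, ContinuousMap.smul_apply,
    ← Nat.cast_pow, Nat.cast_smul_eq_nsmul]
  change φ.1 g - p ^ k • d₀ g = (subgroupRep (tateRep W p).toTopRep U).ρ g m - m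
  rw [hd₀]
  simp only [c', sub_sub_cancel]

/-- **`ker (red_{p^k} : H¹(U, T_pW) → H¹(U, W[p^k])) = p^k · H¹(U, T_pW)`** (Kato §13.8 at the level `U`,
modulo `p^k`): `red_{p^k} x = 0 ↔ ∃ z, x = p^k • z` (`exists_pow_smul_eq_of_reduceH1Pk_eq_zero` and the
tree's converse `reduceH1Pk_pow_smul`). [cite: Kato2004Asterisque, §13.8 (pp. 228–229) and §8.2 (p. 181)] -/
theorem reduceH1Pk_eq_zero_iff (k : ℕ) (U : Subgroup (absoluteGaloisGroup ℚ)) (x : H1 (tateRep W p) U) :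
    reduceH1Pk W p k U x = 0 ↔ ∃ z : H1 (tateRep W p) U, ((p : ℤ_[p]) ^ k) • z = x := by
  refine ⟨exists_pow_smul_eq_of_reduceH1Pk_eq_zero W p k U x, ?_⟩
  rintro ⟨z, rfl⟩
  exact reduceH1Pk_pow_smul W p k U z

end Literature.NumberTheory.EllipticCurves.Kato2004

end
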